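import Summits.ValiantsHypothesis.ValiantsHypothesis.Theorems.BarrierLeverSuccinctHittingSetsForVPKRSTEdge
import Summits.ValiantsHypothesis.ValiantsHypothesis.Theorems.BarrierLeverKRSTNoGoBelow12cOnB05CharSum
import Summits.ValiantsHypothesis.ValiantsHypothesis.Theorems.BarrierLeverKRSTNoGoBelow12cOnB05LinForms
import Summits.ValiantsHypothesis.ValiantsHypothesis.Theorems.BarrierLeverKRSTNoGoBelow12cOnB05InitialForms
import Literature.Computability.AlgebraicComplexity.CircuitConstantCount
import Literature.Computability.AlgebraicComplexity.KRSTSelection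

/-!
# Route BarrierLever — item `KRSTNoGoBelow12cOnB05` (stmt-ValiantsHypothesis-19340), part 4/6:
# THE REDUCTION — KRST's generator is not ideal-succinct for `SmallCircuits ℂ n b` as soon as more
# than `4 n^b + 1` characters `μ ↦ ψ(λ g_μ(a_q))` are linearly independent

Lean text authored by the cell planner seat `valiant-natproofs-p2` (gen 3, HOME/RowZero-p2g3.lean v5
§E.0, §E.5–§E.8, referee REF-P2G3B / REF-ITEMS-g9 PASS), landed by the prover seat over the TREE's
`KRSTEdge.krstGen` / `KRSTEdge.IsIdealSuccinctGenerator` / `KRSTEdge.absc` /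
`KRSTEdge.eval_ofFn_expCoeffs` / `KRSTEdge.bind₁_perPoly` and the Literature constant count
`exists_equation_of_complexity_le`.

* §E.0 `not_idealSuccinct_of_algebraicIndependent` — RANK FORM of the ideal edge: `K > 4 n^b + 1`
  algebraically independent outputs ⇒ not ideal-succinct for `SmallCircuits ℂ n b` (constant count).
* `gOf n μ` (`g_μ : 𝔽_p → 𝔽_p`), `ab hmp q` (the abscissa of matrix position `q`), `psi_mul_gOf`
  (`ψ(λ g_μ(a)) = Π_t ψ(λ a^t)^{μ_t}` = the simplex character `CharSum.chi`), `toSimplex`.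
* §E.6 `krstGen_onePlusX` — under the FULL substitution `X ↦ 1 + X` output `μ` becomes
  `perm(1 + X_{cell(i,j)})`, whose linear part is `(m-1)!·Σ_q X_{(a_q, g_μ(a_q))}`
  (`homogeneousComponent_one_permanent`).
* §E.7 `rowVecFull`, `char_mem_span_full` — every character `μ ↦ ψ(λ g_μ(a_q))` lies in the column
  span of the full 0/1 incidence matrix `(μ, (x,w)) ↦ [∃ q, x = a_q ∧ g_μ(a_q) = w]`.
* §E.8 **`krst_not_idealSuccinct_of_charIndependent_full`** (independent characters ⇒ independent
  incidence rows ⇒ independent linear parts ⇒ algebraically independent outputs by INITIAL FORMS ⇒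
  §E.0) and **`krst_not_idealSuccinct_of_twoTermBounds_full`** (independence discharged by the
  Gershgorin criterion `CharSum.linearIndependent_chi`: pairwise short two-term sums
  `|Σ_{t<n} ψ(i(λ_β a_β^t − λ_α a_α^t))| ≤ K`, `(|I|-1)·C(K+n,n) < C(2n,n)`, `|I| > 4n^b + 1`).

WHAT THIS IS NOT: no exponential-sum estimate is proved here; unconditional bookkeeping only; nothing
about other generators / FSV Question 6.

References: [KumarRamyaSaptharishiTengse2022] §3.3–§3.5; [Bourgain2005] Thm 2 (used only later, as a
hypothesis).
-/

-- layout Summits/ValiantsHypothesis/ValiantsHypothesis forces the duplicated namespace component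
set_option linter.dupNamespace false

noncomputable section

namespace Summit.ValiantsHypothesis.ValiantsHypothesis.Theorems.BarrierLever.KRSTNoGoBelow12cOnB05

open Literature.Barriers.ValiantsHypothesis Literature.Computability.AlgebraicComplexity MvPolynomial
open Summit.ValiantsHypothesis.ValiantsHypothesis.Theorems.BarrierLever.SuccinctHittingSetsForVP
open Summit.ValiantsHypothesis.ValiantsHypothesis.Theorems.BarrierLever.SuccinctHittingSetsForVP.KRSTEdge
open Summit.ValiantsHypothesis.ValiantsHypothesis.Theorems.BarrierLever.KRSTNoGoBelow12cOnB05.CharSum (ψ)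
open Literature.Computability.MetaComplexity (eval_ofFn_eq_sum leastPrimeGe leastPrimeGe_spec leastPrimeGe_le)

/-! ### E.0 Rank form of the ideal edge against the tree's `IsIdealSuccinctGenerator` (= HOME/Sketch-p2g3 §10) -/

/-- `K > 4 n^b + 1` algebraically independent outputs ⇒ not ideal-succinct for `SmallCircuits ℂ n b`. -/
theorem not_idealSuccinct_of_algebraicIndependent {n b : ℕ} {τ : Type*} {M : Set (Fin n →₀ ℕ)}
    {G : M → MvPolynomial τ ℂ} {K : ℕ} (E : Fin K → M)
    (hind : AlgebraicIndependent ℂ fun i => G (E i)) (hK : 4 * n ^ b + 1 < K) :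
    ¬ IsIdealSuccinctGenerator M (SmallCircuits ℂ n b) G := by
  intro hsucc
  obtain ⟨D, hD0, hvan⟩ :=
    exists_equation_of_complexity_le (F := ℂ) (σ := Fin n) (n ^ b) hK
      (fun i => ((E i : M) : Fin n →₀ ℕ))
  have h1 : bind₁ G (rename E D) = 0 := by
    refine hsucc (rename E D) fun g hg => ?_
    have hg' : g.totalDegree ≤ n ∧ complexity g ≤ n ^ b := hg
    rw [eval_rename]
    exact hvan g hg'.2
  rw [bind₁_rename] at h1
  exact hD0 (hind.eq_zero_of_aeval_eq_zero D h1)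

variable {p : ℕ} [Fact p.Prime]

/-! ### E.2 The functions `g_μ` and the abscissae of the matrix positions -/

/-- `g_μ` as a function `𝔽_p → 𝔽_p`. -/
def gOf (n : ℕ) (μ : degLEMonomials n) (x : ZMod p) : ZMod p :=
  (Polynomial.ofFn (n + 1) (expCoeffs p n μ)).eval x

/-- The abscissa of matrix position `(i, j)` of `Perm_[p]`. -/
def ab {m : ℕ} (hmp : m * m ≤ p) (q : Fin m × Fin m) : ZMod p := absc p (permPad hmp q)

/-- Distinct matrix positions have distinct abscissae. -/
theorem ab_injective {m : ℕ} (hmp : m * m ≤ p) : Function.Injective (ab hmp) :=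
  fun _ _ h => (permPad hmp).injective ((absc p).injective h)

/-! ### E.5 In coordinates: `ψ(λ g_μ(a)) = Π_t ψ(λ a^t)^{μ_t}` -/

/-- An additive character turns finite sums into products. -/
theorem addChar_map_sum_eq_prod {A M : Type*} [AddCommMonoid A] [CommMonoid M] (χ : AddChar A M)
    {ι : Type*} (s : Finset ι) (f : ι → A) : χ (∑ i ∈ s, f i) = ∏ i ∈ s, χ (f i) := by
  classical
  induction s using Finset.induction_on with
  | empty => simp [AddChar.map_zero_eq_one]
  | insert a s ha ih => rw [Finset.sum_insert ha, Finset.prod_insert ha, AddChar.map_add_eq_mul, ih]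

/-- The character attached to abscissa `a` and frequency `λ` is the simplex character of `CharSum` with
exponent vector `t ↦ λ a^t`. -/
theorem psi_mul_gOf (n : ℕ) (μ : degLEMonomials n) (lam a : ZMod p) :
    (ψ (lam * gOf n μ a) : ℂ) =
      CharSum.chi (fun t : Fin n => lam * a ^ (t : ℕ)) (fun t => (μ : Fin n →₀ ℕ) t) := by
  unfold gOf CharSum.chi
  rw [eval_ofFn_expCoeffs, Finset.mul_sum, addChar_map_sum_eq_prod]
  refine Finset.prod_congr rfl fun t _ => ?_
  rw [← AddChar.map_nsmul_eq_pow, nsmul_eq_mul]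
  congr 1
  ring

/-- The exponent-vector map `degLEMonomials n → simplex n n` (a bijection; surjectivity is what we use). -/
def toSimplex (n : ℕ) (μ : degLEMonomials n) : ↥(CharSum.simplex n n) :=
  ⟨fun t => (μ : Fin n →₀ ℕ) t, by
    rw [CharSum.mem_simplex, ← Finsupp.degree_eq_sum]
    exact μ.2⟩

/-- Every point of the simplex is the exponent vector of a coordinate of `degLEMonomials n`. -/
theorem toSimplex_surjective (n : ℕ) : Function.Surjective (toSimplex n) := by
  intro ν
  refine ⟨⟨Finsupp.equivFunOnFinite.symm ν.1, ?_⟩, ?_⟩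
  · show (Finsupp.equivFunOnFinite.symm ν.1).degree ≤ n
    rw [Finsupp.degree_eq_sum]
    have := CharSum.mem_simplex.mp ν.2
    simpa [Finsupp.coe_equivFunOnFinite_symm] using this
  · apply Subtype.ext
    funext t
    simp [toSimplex]

/-! ### E.6 The FULL substitution `H(x,w) = 1 + X_(x,w)`: linear parts over ALL `m²` abscissae -/

/-- The cell `(a_q, g_μ(a_q))` of matrix position `q`. -/
def cellOf {n m : ℕ} (hmp : m * m ≤ p) (μ : degLEMonomials n) (q : Fin m × Fin m) : ZMod p × ZMod p :=
  (ab hmp q, gOf n μ (ab hmp q))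

/-- The cells of distinct matrix positions are distinct (their abscissae differ). -/
theorem cellOf_injective {n m : ℕ} (hmp : m * m ≤ p) (μ : degLEMonomials n) :
    Function.Injective (cellOf hmp μ) :=
  fun _ _ h => ab_injective hmp (congrArg Prod.fst h)

/-- Under `X_(x,w) ↦ 1 + X_(x,w)` output `μ` becomes the permanent of `(1 + X_{cell(i,j)})_{i,j}`. -/
theorem krstGen_onePlusX {n m : ℕ} (hmp : m * m ≤ p) (F : Type*) [CommRing F] (μ : degLEMonomials n) :
    bind₁ (fun xw => (1 + X xw : MvPolynomial (ZMod p × ZMod p) F)) (krstGen F p n hmp μ) =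
      (Matrix.of fun i j : Fin m => (1 + X (cellOf hmp μ (i, j)) : MvPolynomial (ZMod p × ZMod p) F)).permanent := by
  show bind₁ _ (rename (⇑(krstDesign p n μ)) (rename (permPad hmp) (perPoly (Fin m) F))) = _
  rw [bind₁_rename, bind₁_rename, bind₁_perPoly]
  rfl

/-- The LINEAR PART of that permanent is `(m-1)! · Σ_q X_{cell q}` (every variable occurs in exactly one
entry; `#{σ : σ i = j} = (m-1)!`). -/
theorem homogeneousComponent_one_permanent {m : ℕ} {F : Type*} [Field F] {κ : Type*} (cell : Fin m × Fin m → κ) :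
    homogeneousComponent 1 ((Matrix.of fun i j : Fin m => (1 + X (cell (i, j)) : MvPolynomial κ F)).permanent) =
      ((m - 1).factorial : F) • ∑ q : Fin m × Fin m, (X (cell q) : MvPolynomial κ F) := by
  classical
  unfold Matrix.permanent
  simp only [Matrix.of_apply]
  rw [map_sum]
  simp_rw [Jac.homogeneousComponent_one_prod_one_add_X]
  rw [Finset.sum_comm, Fintype.sum_prod_type_right, Finset.smul_sum]
  refine Finset.sum_congr rfl fun i _ => ?_
  rw [← Finset.sum_fiberwise Finset.univ (fun σ : Equiv.Perm (Fin m) => σ i)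
    (fun σ : Equiv.Perm (Fin m) => (X (cell (σ i, i)) : MvPolynomial κ F)), Finset.smul_sum]
  refine Finset.sum_congr rfl fun j _ => ?_
  rw [Finset.sum_congr rfl (fun σ hσ => by rw [(Finset.mem_filter.mp hσ).2] :
    ∀ σ ∈ Finset.univ.filter (fun σ : Equiv.Perm (Fin m) => σ i = j),
      (X (cell (σ i, i)) : MvPolynomial κ F) = X (cell (j, i)))]
  rw [Finset.sum_const, Glue.card_filter_perm_apply_eq, Fintype.card_fin, Nat.cast_smul_eq_nsmul]

/-! ### E.7 Full incidence rows and the characters in their column span -/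

/-- The 0/1 row of the FULL incidence matrix at `μ`: indicator of `{(a_q, g_μ(a_q)) : q ∈ m × m}`. -/
def rowVecFull {n m : ℕ} (hmp : m * m ≤ p) (μ : degLEMonomials n) : ZMod p × ZMod p → ℂ :=
  ∑ q : Fin m × Fin m, Pi.single (cellOf hmp μ q) 1

/-- The full incidence row at an abscissa `a_q` of the matrix: indicator of `w = g_μ(a_q)`. -/
theorem rowVecFull_apply_ab {n m : ℕ} (hmp : m * m ≤ p) (μ : degLEMonomials n)
    (q : Fin m × Fin m) (v : ZMod p) :
    rowVecFull hmp μ (ab hmp q, v) = if gOf n μ (ab hmp q) = v then 1 else 0 := by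
  classical
  unfold rowVecFull
  rw [Finset.sum_apply, Finset.sum_eq_single q]
  · rw [Pi.single_apply]
    by_cases h : gOf n μ (ab hmp q) = v
    · rw [if_pos h, if_pos (by rw [cellOf, h])]
    · rw [if_neg h, if_neg (fun heq => h (congrArg Prod.snd heq).symm)]
  · intro q' _ hq'
    rw [Pi.single_apply, if_neg]
    intro heq
    exact hq' (ab_injective hmp (congrArg Prod.fst heq)).symm
  · intro h; exact absurd (Finset.mem_univ _) h

/-- The linear form of (a multiple of) the full incidence row is `a · Σ_q X_{cell q}`. -/
theorem linForm_smul_rowVecFull {n m : ℕ} (hmp : m * m ≤ p) (μ : degLEMonomials n) (a : ℂ) :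
    Glue.linForm (a • rowVecFull hmp μ) =
      a • ∑ q : Fin m × Fin m, (X (cellOf hmp μ q) : MvPolynomial (ZMod p × ZMod p) ℂ) := by
  classical
  rw [Glue.linForm_smul, rowVecFull, Glue.linForm_sum]
  congr 1
  refine Finset.sum_congr rfl fun q _ => ?_
  rw [Glue.linForm_single, one_smul]

/-- For EVERY abscissa `a_q` of the matrix and every frequency, the character `μ ↦ ψ(λ g_μ(a_q))` is in the
column span of the full incidence matrix. -/
theorem char_mem_span_full {n m : ℕ} (hmp : m * m ≤ p) (q : Fin m × Fin m) (lam : ZMod p) :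
    (fun μ : degLEMonomials n => (ψ (lam * gOf n μ (ab hmp q)) : ℂ)) ∈
      Submodule.span ℂ (Set.range fun y : ZMod p × ZMod p =>
        fun μ : degLEMonomials n => rowVecFull hmp μ y) := by
  have hfun : (fun μ : degLEMonomials n => (ψ (lam * gOf n μ (ab hmp q)) : ℂ)) =
      ∑ v : ZMod p, (ψ (lam * v) : ℂ) •
        fun μ : degLEMonomials n => rowVecFull hmp μ (ab hmp q, v) := by
    funext μ
    rw [Finset.sum_apply]
    simp only [Pi.smul_apply, smul_eq_mul, rowVecFull_apply_ab, mul_ite, mul_one, mul_zero]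
    rw [Finset.sum_ite_eq Finset.univ (gOf n μ (ab hmp q)) (fun v => (ψ (lam * v) : ℂ)),
      if_pos (Finset.mem_univ _)]
  rw [hfun]
  exact Submodule.sum_mem _ fun v _ =>
    Submodule.smul_mem _ _ (Submodule.subset_span ⟨(ab hmp q, v), rfl⟩)

/-! ### E.8 The full reduction: characters over ALL `m²` abscissae -/

/-- **KRST's generator is not ideal-succinct for `SmallCircuits ℂ n b` as soon as MORE THAN `4 n^b + 1` of
the characters `μ ↦ ψ(λ_α g_μ(a_{q_α}))` — `a_q` ranging over ALL `m²` abscissae of the matrix — are linearly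
independent.** (Substitution `1 + X`; the linear parts of the outputs are `(m-1)!·L_μ` with `L_μ` the full
incidence rows (§E.6); independent linear parts ⇒ algebraically independent outputs by the initial-form
criterion §F; characters in the column span (§E.7); §E.0.) This is the Jacobian of the generator at the
all-ones seed, made elementary. -/
theorem krst_not_idealSuccinct_of_charIndependent_full {n m b : ℕ} (hmp : m * m ≤ p)
    {I : Type*} [Fintype I] (qq : I → Fin m × Fin m) (lam : I → ZMod p)
    (hind : LinearIndependent ℂ fun (α : I) (μ : degLEMonomials n) =>
      (ψ (lam α * gOf n μ (ab hmp (qq α))) : ℂ))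
    (hK : 4 * n ^ b + 1 < Fintype.card I) :
    ¬ IsIdealSuccinctGenerator (degLEMonomials n) (SmallCircuits ℂ n b) (krstGen ℂ p n hmp) := by
  classical
  obtain ⟨e, _, hrows⟩ := Glue.exists_linearIndependent_rows (F := ℂ)
    (fun (μ : degLEMonomials n) (y : ZMod p × ZMod p) => rowVecFull hmp μ y)
    (fun (α : I) (μ : degLEMonomials n) => (ψ (lam α * gOf n μ (ab hmp (qq α))) : ℂ)) hind
    (fun α => char_mem_span_full hmp (qq α) (lam α))
  set a : ℂ := ((m - 1).factorial : ℂ) with ha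
  have ha0 : a ≠ 0 := by rw [ha]; exact_mod_cast Nat.factorial_ne_zero _
  let c : Fin (Fintype.card I) → ZMod p × ZMod p → ℂ := fun k => a • rowVecFull hmp (e k)
  have hc : LinearIndependent ℂ c := by
    have h := hrows.units_smul fun _ : Fin (Fintype.card I) => Units.mk0 a ha0
    have hcw : c = ((fun _ : Fin (Fintype.card I) => Units.mk0 a ha0) •
        fun (k : Fin (Fintype.card I)) (y : ZMod p × ZMod p) => rowVecFull hmp (e k) y) := by
      funext k
      rw [Pi.smul_apply', Units.smul_def, Units.val_mk0]
    rw [hcw]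
    exact h
  have halg : AlgebraicIndependent ℂ fun k => Glue.linForm (c k) := Glue.algebraicIndependent_linForm c hc
  let H : ZMod p × ZMod p → MvPolynomial (ZMod p × ZMod p) ℂ := fun xw => 1 + X xw
  have h1 : (fun k => homogeneousComponent 1 (bind₁ H (krstGen ℂ p n hmp (e k)))) =
      fun k => Glue.linForm (c k) := by
    funext k
    rw [krstGen_onePlusX, homogeneousComponent_one_permanent, linForm_smul_rowVecFull]
  have hcomp : AlgebraicIndependent ℂ fun k => bind₁ H (krstGen ℂ p n hmp (e k)) :=
    Jac.algebraicIndependent_of_homogeneousComponent_one _ (by rw [h1]; exact halg)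
  have hind' : AlgebraicIndependent ℂ fun k => krstGen ℂ p n hmp (e k) :=
    AlgebraicIndependent.of_comp (bind₁ H) hcomp
  exact not_idealSuccinct_of_algebraicIndependent e hind' hK

/-- **Full two-term-bound form (memo §4c upgraded to ALL abscissae: conditional band `b < 12c`).** If the
abscissa/frequency data `(a_{q_α}, λ_α)_{α∈I}` (ANY matrix positions `q_α`) has all pairwise short two-term
sums `|Σ_{t<n} ψ(i(λ_β a_{q_β}^t − λ_α a_{q_α}^t))| ≤ K` (`1 ≤ i ≤ n`), `(|I|-1)·C(K+n,n) < |simplex|` and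
`|I| > 4n^b + 1`, then KRST's generator is not ideal-succinct for `SmallCircuits ℂ n b`. At KRST scale the
admissible `I` has size `≈ p^{2-2ε} ≈ n^{12c(1-ε)}` ([B05] Thm 2 with `r ∈ {1,2}`), whence every `b < 12c`
— the full residual band below the dimension ceiling — conditionally. -/
theorem krst_not_idealSuccinct_of_twoTermBounds_full {n m b : ℕ} (hmp : m * m ≤ p)
    {I : Type*} [Fintype I] [DecidableEq I] (qq : I → Fin m × Fin m) (lam : I → ZMod p) (K : ℕ)
    (hB : ∀ α β, α ≠ β → ∀ i, 1 ≤ i → i ≤ n →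
      ‖∑ t : Fin n, (ψ ((i : ZMod p) * (lam β * ab hmp (qq β) ^ (t : ℕ) -
          lam α * ab hmp (qq α) ^ (t : ℕ))) : ℂ)‖ ≤ K)
    (hdom : ((Fintype.card I - 1 : ℕ) : ℝ) * ((K + n).choose n : ℝ) < (CharSum.simplex n n).card)
    (hK : 4 * n ^ b + 1 < Fintype.card I) :
    ¬ IsIdealSuccinctGenerator (degLEMonomials n) (SmallCircuits ℂ n b) (krstGen ℂ p n hmp) := by
  have hchi := CharSum.linearIndependent_chi
    (fun α (t : Fin n) => lam α * ab hmp (qq α) ^ (t : ℕ)) n K hB hdom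
  have hinj : LinearMap.ker (LinearMap.funLeft ℂ ℂ (toSimplex n)) = ⊥ :=
    LinearMap.ker_eq_bot.mpr (LinearMap.funLeft_injective_of_surjective ℂ ℂ _ (toSimplex_surjective n))
  have h2 := hchi.map' _ hinj
  refine krst_not_idealSuccinct_of_charIndependent_full hmp qq lam ?_ hK
  have hfun : (fun (α : I) (μ : degLEMonomials n) => (ψ (lam α * gOf n μ (ab hmp (qq α))) : ℂ)) =
      (⇑(LinearMap.funLeft ℂ ℂ (toSimplex n)) ∘ fun (α : I) (ν : ↥(CharSum.simplex n n)) =>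
        CharSum.chi (fun t : Fin n => lam α * ab hmp (qq α) ^ (t : ℕ)) (ν : Fin n → ℕ)) := by
    funext α μ
    rw [Function.comp_apply, LinearMap.funLeft_apply, psi_mul_gOf]
    rfl
  rw [hfun]
  exact h2

end Summit.ValiantsHypothesis.ValiantsHypothesis.Theorems.BarrierLever.KRSTNoGoBelow12cOnB05

end
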